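import Summits.QuantumFields.YangMills.Theorems.FlatTubeReductionOffTubeSuppressionPrelim
import Summits.QuantumFields.YangMills.Theses.FlatTubeReduction
import HarnessLib

/-!
# Off-tube suppression for the zero-flux `SU(2)` transfer form on `(ℤ/L)³`: the re-orthogonalised action-tube truncation
# (crux K2 `OffTubeSuppression` of route `FlatTubeReduction`, item stmt-QuantumFields-24721, PROVED; rung R2b1 = RECORD-label femto gap)

Seat `ym-line-sfw-p1` g9 (prover; planner-of-record ym-idea-1).  The TIGHTEN step of the flat-tube reduction of the fixed-lattice Lüscher law:
for every lattice size `L`, every `θ ∈ (0,1)` and all `β ≥ β₀(L,θ)`, every physical zero-flux test function `ψ ⊥ Ω` (`Ω` the exact positive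
ground state, `K_βΩ = λ₀Ω`) is dominated by a physical `ψ' ⊥ Ω` SUPPORTED IN THE ACTION TUBE `{S ≤ β^{−θ}}`, with `‖ψ'‖² ≤ ‖ψ‖²` and
`⟨ψ,K_βψ⟩ ≤ ⟨ψ',K_βψ'⟩ + (λ_b³/L)·λ₀·‖ψ‖²` (`λ_b = bareLambda β`, `λ_b³ = 2/β`).  ★★ `OffTube.offTubeSuppression_core` is VERBATIM the body of
`Summit.QuantumFields.YangMills.Theses.FlatTubeReduction.OffTubeSuppression`, and ★★★ `FlatTubeReduction.offTubeSuppression_proof` concludes that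
route decl BY NAME (closes item stmt-QuantumFields-24721).

Construction: `ψ' = 1_T ψ − a·1_T Ω`, `T = {S ≤ η}`, `η = β^{−θ}`, `a = ⟨1_Tψ, Ω⟩/‖1_TΩ‖²`.  Proof = Hilbert-space bookkeeping
(`FlatTubeReductionOffTubeSuppressionPrelim.lean`) on top of three tree estimates of route LuscherReduction's fixed-lattice programme (RED lane):
the LARGE-FIELD SUPPRESSION `qform_le_exp_neg_of_action_ge_lat` (`⟨u,K_βu⟩ ≤ e^{−βη}c_β^{|E|}‖u‖²` for `u` supported in `{S ≥ η}`), the β-UNIFORM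
VACUUM FLOOR `levelValue_zero_ge_uniform` (`λ₀ ≥ c_L·c_β^{|E|}`), and Cauchy–Schwarz for the positive transfer form (`sq_qform_le`) and for `l2`
(`sq_l2_le`).  With `κ = e^{−βη}c_β^{|E|}`, `u = 1_{Tᶜ}ψ`, `v = 1_TΩ`, `w = 1_{Tᶜ}Ω`:
`⟨ψ,Kψ⟩ − ⟨ψ',Kψ'⟩ = a²⟨v,Kv⟩ + ⟨u,Ku⟩ + 2a⟨ψ',Kv⟩ + 2⟨ψ',Ku⟩ + 2a⟨v,Ku⟩` with `⟨ψ',Kv⟩ = −⟨ψ',Kw⟩` (`⟨ψ',KΩ⟩ = λ₀⟨ψ',Ω⟩ = 0`),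
`a‖v‖² = −⟨u,w⟩`, `λ₀‖w‖² ≤ κ‖Ω‖²` (tail), each cross term `≤ √(λ₀κ)‖ψ‖²`, so the defect is `≤ (3κ + 6√(λ₀κ))‖ψ‖² ≤ 9√(λ₀κ)‖ψ‖²`, and
`81κ ≤ (λ_b³/L)²λ₀` as soon as `225·β²e^{−β^{1−θ}} ≤ 4c_L/L²`.

HONEST FRAMING: this is the elementary half (K2, planner difficulty M) of a layer-2 split of FemtoCutoffLadder's fixed-lattice node
(stmt-QuantumFields-23943 = leaf `FemtoGapFixedLattice`); K1 `NearFlatRatioLaw` (the degenerate toron-valley Born–Oppenheimer comparison) and the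
two shared ladder legs `OctaveStepDecay` / `SubOctaveBounded` are OPEN and untouched.  R2b1 is a RECORD rung: nothing here is a statement about
infinite volume, the continuum, or the Clay Yang–Mills mass gap.  No definitions, no named facts, no `sorry`.
-/

set_option autoImplicit false

noncomputable section

open MeasureTheory Filter Topology Real
open Literature.MathematicalPhysics.QuantumFieldTheory
open Literature.MathematicalPhysics.QuantumLattice

namespace Summit.QuantumFields.YangMills.Theorems.FemtoTransferGap

namespace OffTube

variable {L : ℕ} [NeZero L]

/-! ## §6 The re-orthogonalised tube truncation -/
set_option maxHeartbeats 400000 in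
/-- ★★ **Off-tube suppression** — VERBATIM the body of the route decl
`Summit.QuantumFields.YangMills.Theses.FlatTubeReduction.OffTubeSuppression` (item stmt-QuantumFields-24721, crux K2, planner difficulty M).
For every `L` and `θ ∈ (0,1)` there is `β₀` such that for `β ≥ β₀`, every exact positive physical ground state `Ω` (`K_βΩ = λ₀Ω`) and every
physical `ψ ⊥ Ω` admit a physical `ψ' ⊥ Ω` supported in the action tube `{S ≤ β^{−θ}}` with `‖ψ'‖² ≤ ‖ψ‖²` and
`⟨ψ,K_βψ⟩ ≤ ⟨ψ',K_βψ'⟩ + (λ_b(β)³/L)·λ₀(β,L)·‖ψ‖²`.  Witness `ψ' = 1_Tψ − a·1_TΩ`, `a = ⟨1_Tψ,Ω⟩/‖1_TΩ‖²`; see the module docstring for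
the estimate.  (The hypothesis `0 < θ` is not used: the construction works for every `θ < 1`.) [cite: Luscher1983, §2]
[cite: ReedSimonIV1978, Thm. XIII.1] -/
theorem offTubeSuppression_core (L : ℕ) [NeZero L] (θ : ℝ) (_hθ0 : 0 < θ) (hθ1 : θ < 1) :
    ∃ β0 : ℝ, ∀ β : ℝ, β0 ≤ β →
      ∀ (Ω ψ : GaugeConfig 3 L SU2 → ℝ), IsPhys Ω → (∀ U, 0 < Ω U) →
        transferApply β Ω = topValue su2Rep L β • Ω → IsPhys ψ → l2 ψ Ω = 0 →
          ∃ ψ' : GaugeConfig 3 L SU2 → ℝ, IsPhys ψ' ∧ l2 ψ' Ω = 0 ∧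
            (∀ U, β ^ (-θ) < wilsonAction su2Rep U → ψ' U = 0) ∧
            l2 ψ' ψ' ≤ l2 ψ ψ ∧
            qform su2Rep β ψ ψ ≤ qform su2Rep β ψ' ψ' + bareLambda β ^ 3 / L * topValue su2Rep L β * l2 ψ ψ := by
  have hL : (0 : ℝ) < L := by exact_mod_cast Nat.pos_of_ne_zero (NeZero.ne L)
  have hL1 : (1 : ℝ) ≤ L := by exact_mod_cast NeZero.one_le
  have hcL0 : 0 < uniformFloorConst L := uniformFloorConst_pos
  obtain ⟨β1, hβ1⟩ := eventually_sq_mul_exp_le hθ1 (c := 4 * uniformFloorConst L / (225 * (L : ℝ) ^ 2)) (by positivity)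
  refine ⟨max β1 1, fun β hβ Ω ψ hΩ hΩpos heig hψ horth => ?_⟩
  have hβ1' : β1 ≤ β := (le_max_left _ _).trans hβ
  have hβone : (1 : ℝ) ≤ β := (le_max_right _ _).trans hβ
  have hβ0 : 0 < β := by linarith
  /- the scales `η = β^{−θ}`, `λ₀`, `κ = e^{−βη}c_β^{|E|}`, `ε = λ_b³/L = 2/(βL)` -/
  set η : ℝ := β ^ (-θ) with hη
  have hlam0 : 0 < topValue su2Rep L β := topValue_su2Rep_pos L β
  have hκ0 : 0 < Real.exp (-(β * η)) * latCE L β := mul_pos (Real.exp_pos _) (latCE_pos hβ0.le)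
  have hb3 : bareLambda β ^ 3 = 2 / β := by
    rw [eq_div_iff hβ0.ne', mul_comm]; exact bareLambda_cube hβ0
  have hε2 : bareLambda β ^ 3 / L = 2 / (β * L) := by rw [hb3, div_div]
  have hε0 : 0 ≤ bareLambda β ^ 3 / L := by rw [hε2]; positivity
  have hεle : bareLambda β ^ 3 / L ≤ 2 := by
    rw [hε2, div_le_iff₀ (by positivity)]
    nlinarith [hβone, hL1]
  -- the floor and the smallness condition: `225 κ ≤ ε² λ₀`
  have hfloor : uniformFloorConst L * latCE L β ≤ topValue su2Rep L β := by
    have h := levelValue_zero_ge_uniform (L := L) hβone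
    rwa [levelValue_zero] at h
  have hA : β ^ 2 * Real.exp (-(β * η)) ≤ 4 * uniformFloorConst L / (225 * (L : ℝ) ^ 2) := hβ1 β hβ1'
  have hstar : 225 * (Real.exp (-(β * η)) * latCE L β) ≤ (bareLambda β ^ 3 / L) ^ 2 * topValue su2Rep L β := by
    have hA' : 225 * Real.exp (-(β * η)) * (β ^ 2 * (L : ℝ) ^ 2) ≤ 4 * uniformFloorConst L := by
      rw [le_div_iff₀ (by positivity)] at hA
      nlinarith [hA]
    have hB : 225 * Real.exp (-(β * η)) ≤ (bareLambda β ^ 3 / L) ^ 2 * uniformFloorConst L := by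
      rw [hε2, div_pow, div_mul_eq_mul_div, le_div_iff₀ (by positivity)]
      calc 225 * Real.exp (-(β * η)) * (β * L) ^ 2 = 225 * Real.exp (-(β * η)) * (β ^ 2 * (L : ℝ) ^ 2) := by ring
        _ ≤ 4 * uniformFloorConst L := hA'
        _ = 2 ^ 2 * uniformFloorConst L := by norm_num
    calc 225 * (Real.exp (-(β * η)) * latCE L β) = (225 * Real.exp (-(β * η))) * latCE L β := by ring
      _ ≤ ((bareLambda β ^ 3 / L) ^ 2 * uniformFloorConst L) * latCE L β :=
          mul_le_mul_of_nonneg_right hB (latCE_pos hβ0.le).le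
      _ = (bareLambda β ^ 3 / L) ^ 2 * (uniformFloorConst L * latCE L β) := by ring
      _ ≤ (bareLambda β ^ 3 / L) ^ 2 * topValue su2Rep L β := mul_le_mul_of_nonneg_left hfloor (sq_nonneg _)
  have hκlam : 2 * (Real.exp (-(β * η)) * latCE L β) ≤ topValue su2Rep L β := by
    have hε4 : (bareLambda β ^ 3 / L) ^ 2 ≤ 4 := by nlinarith [hε0, hεle]
    have h4 : (bareLambda β ^ 3 / L) ^ 2 * topValue su2Rep L β ≤ 4 * topValue su2Rep L β :=
      mul_le_mul_of_nonneg_right hε4 hlam0.le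
    linarith [hstar, h4, hκ0]
  /- the tube and the four pieces -/
  set T : Set (GaugeConfig 3 L SU2) := {U | wilsonAction su2Rep U ≤ η} with hT
  have hTη : ∀ U, U ∉ T → η ≤ wilsonAction su2Rep U := fun U hU => by
    simp only [hT, Set.mem_setOf_eq, not_le] at hU
    exact hU.le
  have hcψ : IsPhys (T.indicator ψ) := isPhys_indicator_tube η hψ
  have hu : IsPhys (Tᶜ.indicator ψ) := isPhys_indicator_tube_compl η hψ
  have hv : IsPhys (T.indicator Ω) := isPhys_indicator_tube η hΩ
  have hw : IsPhys (Tᶜ.indicator Ω) := isPhys_indicator_tube_compl η hΩ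
  have huη : ∀ U, Tᶜ.indicator ψ U ≠ 0 → η ≤ wilsonAction su2Rep U := fun U hU =>
    hTη U fun hUT => hU (Set.indicator_of_notMem (fun h : U ∈ Tᶜ => (Set.mem_compl_iff T U).1 h hUT) ψ)
  have hwη : ∀ U, Tᶜ.indicator Ω U ≠ 0 → η ≤ wilsonAction su2Rep U := fun U hU =>
    hTη U fun hUT => hU (Set.indicator_of_notMem (fun h : U ∈ Tᶜ => (Set.mem_compl_iff T U).1 h hUT) Ω)
  -- norms
  have hP0 : 0 ≤ l2 ψ ψ := l2_self_nonneg ψ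
  have hN0 : 0 < l2 Ω Ω := by
    obtain ⟨c, hc, hcle⟩ := PhysL2.exists_pos_le_of_eigen hlam0 hΩ hΩpos heig
    exact l2_pos_of_le hΩ hΩ hc hc hcle hcle
  have hSv0' : 0 ≤ l2 (T.indicator Ω) (T.indicator Ω) := l2_self_nonneg _
  have hSw0 : 0 ≤ l2 (Tᶜ.indicator Ω) (Tᶜ.indicator Ω) := l2_self_nonneg _
  have hSu0 : 0 ≤ l2 (Tᶜ.indicator ψ) (Tᶜ.indicator ψ) := l2_self_nonneg _
  have hsplitΩ : l2 Ω Ω = l2 (T.indicator Ω) (T.indicator Ω) + l2 (Tᶜ.indicator Ω) (Tᶜ.indicator Ω) :=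
    l2_eq_indicator_add_compl hv hv hw hw
  have hSuP : l2 (Tᶜ.indicator ψ) (Tᶜ.indicator ψ) ≤ l2 ψ ψ := l2_indicator_compl_self_le hcψ hu
  have hScP : l2 (T.indicator ψ) (T.indicator ψ) ≤ l2 ψ ψ := l2_indicator_self_le hcψ hu
  -- the ground-state tail and its consequences `2‖w‖² ≤ ‖Ω‖²`, `‖Ω‖² ≤ 2‖v‖²`
  have htail : topValue su2Rep L β * l2 (Tᶜ.indicator Ω) (Tᶜ.indicator Ω) ≤
      Real.exp (-(β * η)) * latCE L β * l2 Ω Ω := tail_bound hβ0.le hTη hΩ hw heig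
  have h2Sw : 2 * l2 (Tᶜ.indicator Ω) (Tᶜ.indicator Ω) ≤ l2 Ω Ω := by
    have h1 : topValue su2Rep L β * (2 * l2 (Tᶜ.indicator Ω) (Tᶜ.indicator Ω)) ≤ topValue su2Rep L β * l2 Ω Ω := by
      calc topValue su2Rep L β * (2 * l2 (Tᶜ.indicator Ω) (Tᶜ.indicator Ω))
          = 2 * (topValue su2Rep L β * l2 (Tᶜ.indicator Ω) (Tᶜ.indicator Ω)) := by ring
        _ ≤ 2 * (Real.exp (-(β * η)) * latCE L β * l2 Ω Ω) := by linarith [htail]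
        _ = (2 * (Real.exp (-(β * η)) * latCE L β)) * l2 Ω Ω := by ring
        _ ≤ topValue su2Rep L β * l2 Ω Ω := mul_le_mul_of_nonneg_right hκlam hN0.le
    exact le_of_mul_le_mul_left h1 hlam0
  have hSwSv : l2 (Tᶜ.indicator Ω) (Tᶜ.indicator Ω) ≤ l2 (T.indicator Ω) (T.indicator Ω) := by linarith [hsplitΩ, h2Sw]
  have hN2Sv : l2 Ω Ω ≤ 2 * l2 (T.indicator Ω) (T.indicator Ω) := by linarith [hsplitΩ, h2Sw]
  have hSv0 : 0 < l2 (T.indicator Ω) (T.indicator Ω) := by linarith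
  /- the coefficient `a` and the witness `ψ' = 1_Tψ − a·1_TΩ` -/
  set a : ℝ := l2 (T.indicator ψ) Ω / l2 (T.indicator Ω) (T.indicator Ω) with ha
  have haSv : a * l2 (T.indicator Ω) (T.indicator Ω) = l2 (T.indicator ψ) Ω := div_mul_cancel₀ _ hSv0.ne'
  -- `⟨1_Tψ, Ω⟩ = −⟨u, w⟩` from `ψ ⊥ Ω`
  have hsum : l2 (T.indicator ψ) Ω + l2 (Tᶜ.indicator ψ) (Tᶜ.indicator Ω) = 0 := by
    have h := horth
    rw [← Set.indicator_self_add_compl T ψ, l2_add_left hcψ hu hΩ, l2_indicator_left Tᶜ ψ Ω] at h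
    exact h
  have hCSa : l2 (Tᶜ.indicator ψ) (Tᶜ.indicator Ω) ^ 2 ≤
      l2 (Tᶜ.indicator ψ) (Tᶜ.indicator ψ) * l2 (Tᶜ.indicator Ω) (Tᶜ.indicator Ω) := sq_l2_le hu hw
  have hψ' : IsPhys (T.indicator ψ + (-a) • T.indicator Ω) := hcψ.add (hv.smul (-a))
  have hcv : l2 (T.indicator ψ) (T.indicator Ω) = a * l2 (T.indicator Ω) (T.indicator Ω) := by
    rw [haSv, ← l2_indicator_left T ψ Ω]
  -- orthogonality of the witness
  have horth' : l2 (T.indicator ψ + (-a) • T.indicator Ω) Ω = 0 := by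
    rw [l2_add_left hcψ (hv.smul (-a)) hΩ, l2_smul_left, l2_indicator_left T Ω Ω, ← haSv]
    ring
  -- its norm: `‖ψ'‖² = ‖1_Tψ‖² − a²‖1_TΩ‖² ≤ ‖ψ‖²`
  have hnorm_eq : l2 (T.indicator ψ + (-a) • T.indicator Ω) (T.indicator ψ + (-a) • T.indicator Ω) =
      l2 (T.indicator ψ) (T.indicator ψ) - a ^ 2 * l2 (T.indicator Ω) (T.indicator Ω) := by
    rw [l2_add_add hcψ (hv.smul (-a)), l2_comm (T.indicator ψ) ((-a) • T.indicator Ω), l2_smul_left,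
      l2_comm (T.indicator Ω) (T.indicator ψ), hcv, l2_smul_left, l2_comm (T.indicator Ω) ((-a) • T.indicator Ω),
      l2_smul_left]
    ring
  have hnorm : l2 (T.indicator ψ + (-a) • T.indicator Ω) (T.indicator ψ + (-a) • T.indicator Ω) ≤ l2 ψ ψ := by
    rw [hnorm_eq]
    nlinarith [hScP, sq_nonneg a, hSv0.le]
  have hS'0 : 0 ≤ l2 (T.indicator ψ + (-a) • T.indicator Ω) (T.indicator ψ + (-a) • T.indicator Ω) := l2_self_nonneg _
  refine ⟨T.indicator ψ + (-a) • T.indicator Ω, hψ', horth', fun U hU => ?_, hnorm, ?_⟩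
  · -- support in the tube
    have hUT : U ∉ T := by
      simp only [hT, Set.mem_setOf_eq, not_le]
      exact hU
    simp only [Pi.add_apply, Pi.smul_apply, smul_eq_mul, Set.indicator_of_notMem hUT, mul_zero, add_zero]
  /- the main inequality -/
  -- decomposition `ψ = ψ' + r`, `r = a·1_TΩ + 1_{Tᶜ}ψ`
  have hr : IsPhys (a • T.indicator Ω + Tᶜ.indicator ψ) := (hv.smul a).add hu
  have hdec : ψ = (T.indicator ψ + (-a) • T.indicator Ω) + (a • T.indicator Ω + Tᶜ.indicator ψ) := by
    funext U
    have h := congrFun (Set.indicator_self_add_compl T ψ) U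
    simp only [Pi.add_apply] at h
    simp only [Pi.add_apply, Pi.smul_apply, smul_eq_mul]
    linarith
  have hexp : qform su2Rep β ψ ψ =
      qform su2Rep β (T.indicator ψ + (-a) • T.indicator Ω) (T.indicator ψ + (-a) • T.indicator Ω) +
        2 * (a * qform su2Rep β (T.indicator ψ + (-a) • T.indicator Ω) (T.indicator Ω) +
              qform su2Rep β (T.indicator ψ + (-a) • T.indicator Ω) (Tᶜ.indicator ψ)) +
        (a ^ 2 * qform su2Rep β (T.indicator Ω) (T.indicator Ω) +
          2 * (a * qform su2Rep β (T.indicator Ω) (Tᶜ.indicator ψ)) +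
          qform su2Rep β (Tᶜ.indicator ψ) (Tᶜ.indicator ψ)) := by
    have h0 : qform su2Rep β ψ ψ = qform su2Rep β ((T.indicator ψ + (-a) • T.indicator Ω) + (a • T.indicator Ω + Tᶜ.indicator ψ))
        ((T.indicator ψ + (-a) • T.indicator Ω) + (a • T.indicator Ω + Tᶜ.indicator ψ)) := by
      rw [← hdec]
    rw [h0, qform_add_add β hψ' hr, qform_add_right β hψ' (hv.smul a) hu, qform_smul_right β a hψ' hv,
      qform_add_add β (hv.smul a) hu, qform_smul_left, qform_smul_right β a hv hv, qform_smul_left]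
    ring
  -- the individual estimates
  have hQvv : qform su2Rep β (T.indicator Ω) (T.indicator Ω) ≤ topValue su2Rep L β * l2 (T.indicator Ω) (T.indicator Ω) :=
    qform_le_topValue_mul_l2 hβ0.le hv
  have hQuu : qform su2Rep β (Tᶜ.indicator ψ) (Tᶜ.indicator ψ) ≤
      Real.exp (-(β * η)) * latCE L β * l2 (Tᶜ.indicator ψ) (Tᶜ.indicator ψ) :=
    qform_le_exp_neg_of_action_ge_lat hβ0.le hu huη
  have hQpu : qform su2Rep β (T.indicator ψ + (-a) • T.indicator Ω) (Tᶜ.indicator ψ) ^ 2 ≤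
      (topValue su2Rep L β * l2 (T.indicator ψ + (-a) • T.indicator Ω) (T.indicator ψ + (-a) • T.indicator Ω)) *
        (Real.exp (-(β * η)) * latCE L β * l2 (Tᶜ.indicator ψ) (Tᶜ.indicator ψ)) := sq_cross_le hβ0.le hψ' hu huη
  have hQvu : qform su2Rep β (T.indicator Ω) (Tᶜ.indicator ψ) ^ 2 ≤
      (topValue su2Rep L β * l2 (T.indicator Ω) (T.indicator Ω)) *
        (Real.exp (-(β * η)) * latCE L β * l2 (Tᶜ.indicator ψ) (Tᶜ.indicator ψ)) := sq_cross_le hβ0.le hv hu huη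
  have hQpw : qform su2Rep β (T.indicator ψ + (-a) • T.indicator Ω) (Tᶜ.indicator Ω) ^ 2 ≤
      (topValue su2Rep L β * l2 (T.indicator ψ + (-a) • T.indicator Ω) (T.indicator ψ + (-a) • T.indicator Ω)) *
        (Real.exp (-(β * η)) * latCE L β * l2 (Tᶜ.indicator Ω) (Tᶜ.indicator Ω)) := sq_cross_le hβ0.le hψ' hw hwη
  -- `⟨ψ', K 1_TΩ⟩ = −⟨ψ', K 1_{Tᶜ}Ω⟩` since `⟨ψ', KΩ⟩ = λ₀⟨ψ', Ω⟩ = 0`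
  have hQpv : qform su2Rep β (T.indicator ψ + (-a) • T.indicator Ω) (T.indicator Ω) =
      -qform su2Rep β (T.indicator ψ + (-a) • T.indicator Ω) (Tᶜ.indicator Ω) := by
    have h := qform_add_right β hψ' hv hw
    rw [Set.indicator_self_add_compl T Ω, qform_eigen_right β heig, horth', mul_zero] at h
    linarith
  /- pure arithmetic from here on -/
  set lam := topValue su2Rep L β with hlam
  set κ : ℝ := Real.exp (-(β * η)) * latCE L β with hκ
  set ε : ℝ := bareLambda β ^ 3 / L with hε
  set P := l2 ψ ψ with hP
  set N := l2 Ω Ω with hN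
  set Sv := l2 (T.indicator Ω) (T.indicator Ω) with hSv
  set Sw := l2 (Tᶜ.indicator Ω) (Tᶜ.indicator Ω) with hSw
  set Su := l2 (Tᶜ.indicator ψ) (Tᶜ.indicator ψ) with hSu
  set S' := l2 (T.indicator ψ + (-a) • T.indicator Ω) (T.indicator ψ + (-a) • T.indicator Ω) with hS'
  set X := l2 (Tᶜ.indicator ψ) (Tᶜ.indicator Ω) with hX
  set Q' := qform su2Rep β (T.indicator ψ + (-a) • T.indicator Ω) (T.indicator ψ + (-a) • T.indicator Ω) with hQ'
  set Qvv := qform su2Rep β (T.indicator Ω) (T.indicator Ω) with hQvv'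
  set Quu := qform su2Rep β (Tᶜ.indicator ψ) (Tᶜ.indicator ψ) with hQuu'
  set Qpu := qform su2Rep β (T.indicator ψ + (-a) • T.indicator Ω) (Tᶜ.indicator ψ) with hQpu'
  set Qvu := qform su2Rep β (T.indicator Ω) (Tᶜ.indicator ψ) with hQvu'
  set Qpw := qform su2Rep β (T.indicator ψ + (-a) • T.indicator Ω) (Tᶜ.indicator Ω) with hQpw'
  set G : ℝ := Real.sqrt (lam * κ) with hG
  have hG0 : 0 ≤ G := Real.sqrt_nonneg _
  have hlk0 : 0 ≤ lam * κ := mul_nonneg hlam0.le hκ0.le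
  have hG2 : G ^ 2 = lam * κ := Real.sq_sqrt hlk0
  have hGP0 : 0 ≤ G * P := mul_nonneg hG0 hP0
  -- `a·Sv = −X`, `X² ≤ Su·Sw ≤ P·Sw`
  have haX : a * Sv = -X := by linarith [haSv, hsum]
  have hX2 : (a * Sv) ^ 2 ≤ P * Sw := by
    rw [haX, neg_sq]
    exact hCSa.trans (mul_le_mul_of_nonneg_right hSuP hSw0)
  have haSw : a ^ 2 * Sw ≤ P := by
    have h1 : a ^ 2 * Sw * Sv ≤ P * Sv := by
      calc a ^ 2 * Sw * Sv ≤ a ^ 2 * Sv * Sv :=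
            mul_le_mul_of_nonneg_right (mul_le_mul_of_nonneg_left hSwSv (sq_nonneg a)) hSv0.le
        _ = (a * Sv) ^ 2 := by ring
        _ ≤ P * Sw := hX2
        _ ≤ P * Sv := mul_le_mul_of_nonneg_left hSwSv hP0
    exact le_of_mul_le_mul_right h1 hSv0
  have haSv' : a ^ 2 * Sv ≤ P := by
    have h1 : a ^ 2 * Sv * Sv ≤ P * Sv := by
      calc a ^ 2 * Sv * Sv = (a * Sv) ^ 2 := by ring
        _ ≤ P * Sw := hX2
        _ ≤ P * Sv := mul_le_mul_of_nonneg_left hSwSv hP0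
    exact le_of_mul_le_mul_right h1 hSv0
  -- (c1) `a²⟨v,Kv⟩ ≤ 2κP`
  have hc1 : a ^ 2 * Qvv ≤ 2 * (κ * P) := by
    have h1 : lam * a ^ 2 * Sv * Sv ≤ 2 * (κ * P) * Sv := by
      calc lam * a ^ 2 * Sv * Sv = lam * (a * Sv) ^ 2 := by ring
        _ ≤ lam * (P * Sw) := mul_le_mul_of_nonneg_left hX2 hlam0.le
        _ = P * (lam * Sw) := by ring
        _ ≤ P * (κ * N) := mul_le_mul_of_nonneg_left htail hP0
        _ ≤ P * (κ * (2 * Sv)) := mul_le_mul_of_nonneg_left (mul_le_mul_of_nonneg_left hN2Sv hκ0.le) hP0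
        _ = 2 * (κ * P) * Sv := by ring
    have h2 : lam * a ^ 2 * Sv ≤ 2 * (κ * P) := le_of_mul_le_mul_right h1 hSv0
    calc a ^ 2 * Qvv ≤ a ^ 2 * (lam * Sv) := mul_le_mul_of_nonneg_left hQvv (sq_nonneg a)
      _ = lam * a ^ 2 * Sv := by ring
      _ ≤ 2 * (κ * P) := h2
  -- (c2) `⟨u,Ku⟩ ≤ κP`
  have hc2 : Quu ≤ κ * P := hQuu.trans (mul_le_mul_of_nonneg_left hSuP hκ0.le)
  -- (c3) `|a⟨ψ',Kv⟩| ≤ G·P`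
  have hc3 : |a * qform su2Rep β (T.indicator ψ + (-a) • T.indicator Ω) (T.indicator Ω)| ≤ G * P := by
    refine abs_le_of_sq_le_sq ?_ hGP0
    calc (a * qform su2Rep β (T.indicator ψ + (-a) • T.indicator Ω) (T.indicator Ω)) ^ 2 = a ^ 2 * Qpw ^ 2 := by
          rw [hQpv]; ring
      _ ≤ a ^ 2 * ((lam * S') * (κ * Sw)) := mul_le_mul_of_nonneg_left hQpw (sq_nonneg a)
      _ = (lam * κ * S') * (a ^ 2 * Sw) := by ring
      _ ≤ (lam * κ * P) * P :=
          mul_le_mul (mul_le_mul_of_nonneg_left hnorm hlk0) haSw (mul_nonneg (sq_nonneg a) hSw0) (mul_nonneg hlk0 hP0)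
      _ = (G * P) ^ 2 := by rw [mul_pow, hG2]; ring
  -- (c4) `|⟨ψ',Ku⟩| ≤ G·P`
  have hc4 : |Qpu| ≤ G * P := by
    refine abs_le_of_sq_le_sq ?_ hGP0
    calc Qpu ^ 2 ≤ (lam * S') * (κ * Su) := hQpu
      _ ≤ (lam * P) * (κ * P) :=
          mul_le_mul (mul_le_mul_of_nonneg_left hnorm hlam0.le) (mul_le_mul_of_nonneg_left hSuP hκ0.le) (mul_nonneg hκ0.le hSu0)
            (mul_nonneg hlam0.le hP0)
      _ = (G * P) ^ 2 := by rw [mul_pow, hG2]; ring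
  -- (c5) `|a⟨v,Ku⟩| ≤ G·P`
  have hc5 : |a * Qvu| ≤ G * P := by
    refine abs_le_of_sq_le_sq ?_ hGP0
    calc (a * Qvu) ^ 2 = a ^ 2 * Qvu ^ 2 := by ring
      _ ≤ a ^ 2 * ((lam * Sv) * (κ * Su)) := mul_le_mul_of_nonneg_left hQvu (sq_nonneg a)
      _ = (lam * κ * Su) * (a ^ 2 * Sv) := by ring
      _ ≤ (lam * κ * P) * P :=
          mul_le_mul (mul_le_mul_of_nonneg_left hSuP hlk0) haSv' (mul_nonneg (sq_nonneg a) hSv0.le) (mul_nonneg hlk0 hP0)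
      _ = (G * P) ^ 2 := by rw [mul_pow, hG2]; ring
  -- (c6) `κ ≤ G`, (c7) `9G ≤ ελ₀`
  have hc6 : κ ≤ G := by
    have hκle : κ ≤ lam := by linarith [hκlam, hκ0]
    refine (le_abs_self κ).trans (abs_le_of_sq_le_sq ?_ hG0)
    rw [hG2, sq]
    exact mul_le_mul_of_nonneg_right hκle hκ0.le |>.trans (le_of_eq (by ring))
  have hc7 : 9 * G ≤ ε * lam := by
    have h81 : 81 * κ ≤ ε ^ 2 * lam := by linarith [hstar, hκ0]
    refine (le_abs_self _).trans (abs_le_of_sq_le_sq ?_ (mul_nonneg hε0 hlam0.le))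
    calc (9 * G) ^ 2 = lam * (81 * κ) := by rw [mul_pow, hG2]; ring
      _ ≤ lam * (ε ^ 2 * lam) := mul_le_mul_of_nonneg_left h81 hlam0.le
      _ = (ε * lam) ^ 2 := by ring
  -- assemble
  have e1 : a * qform su2Rep β (T.indicator ψ + (-a) • T.indicator Ω) (T.indicator Ω) ≤ G * P := (le_abs_self _).trans hc3
  have e2 : Qpu ≤ G * P := (le_abs_self _).trans hc4
  have e3 : a * Qvu ≤ G * P := (le_abs_self _).trans hc5
  have e4 : κ * P ≤ G * P := mul_le_mul_of_nonneg_right hc6 hP0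
  have e5 : 9 * (G * P) ≤ ε * lam * P := by
    have := mul_le_mul_of_nonneg_right hc7 hP0
    linarith [this]
  rw [hexp]
  linarith [e1, e2, e3, e4, e5, hc1, hc2]

/-! ## §7 The crux by name -/

/-- ★★★ **Crux K2 `OffTubeSuppression` of route FlatTubeReduction (item stmt-QuantumFields-24721), PROVED**: the route decl by name, from
`OffTube.offTubeSuppression_core`.  R2b1 is a RECORD rung; K1 `NearFlatRatioLaw` and the two shared ladder legs stay open; no summit (in
particular not the Yang–Mills mass gap) is proved by this. [cite: Luscher1983, §2] -/
theorem _root_.Summit.QuantumFields.YangMills.Theorems.FlatTubeReduction.offTubeSuppression_proof :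
    Summit.QuantumFields.YangMills.Theses.FlatTubeReduction.OffTubeSuppression :=
  fun L _ θ hθ0 hθ1 => offTubeSuppression_core L θ hθ0 hθ1

end OffTube

end Summit.QuantumFields.YangMills.Theorems.FemtoTransferGap

end
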